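import Summits.NavierStokesRegularity.NavierStokesRegularity.Theses.ExtremiserTransience
import Summits.NavierStokesRegularity.NavierStokesRegularity.Theorems.ExtremiserTransienceNearExtremalTransienceSharpConstant
import Summits.NavierStokesRegularity.NavierStokesRegularity.Theorems.ExtremiserTransienceAveragedRungSlab

/-!
# BC5 rung for `ExtremiserTransience.NearExtremalTransiencePerFlow` (stmt-NavierStokesRegularity-26567):
# the MONOTONE STRATUM (ns-idea-5 g4, LINE g4-α «per-flow-tangent»)

If ONE flow admits, from some onset `t₁`, a measurable efficiency majorant `k ∈ [0,1]` (the flow-wise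
depletion clause of the crux) which is non-increasing on `[t₁, T)` and strictly sub-extremal at onset,
`k t₁ < κ⋆ = sInf V`, then the per-flow conclusion of the crux holds for that flow with
`θ = k t₁ / κ⋆ < 1` and `B = 0`, uniformly in the universal constant `κ ≥ κ⋆`. Pure calculus on top of
the landed `DepletionLadder.sharpDepletion_gt/_le` and `intervalIntegrable_coeff_sq_div`; nothing dynamic.
Strict sub-extremality at one time is automatic for analytic slices (`DepletionLadder.slice_lt_sharp`), so
the stratum «canonical efficiency eventually non-increasing» of Type-I singular flows satisfies the crux.
Navier–Stokes regularity is NOT proved by anything here; the crux stays open off this stratum.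
-/

noncomputable section
open Set Filter Topology MeasureTheory
open scoped InnerProductSpace RealInnerProductSpace ENNReal NNReal ContDiff

namespace Summit.NavierStokesRegularity.NavierStokesRegularity.Theorems.DepletionLadder.PerFlow
set_option linter.dupNamespace false
set_option linter.style.longLine false

/-- Log-mean of an antitone coefficient: `∫_(t₁)^t k²/(T−τ) ≤ k(t₁)²·log((T−t₁)/(T−t))`. -/
theorem logMean_of_antitone {k : ℝ → ℝ} {T t₁ : ℝ} (hkm : Measurable k)
    (hk01 : ∀ τ, 0 ≤ k τ ∧ k τ ≤ 1) (ht₁ : t₁ < T) (hanti : AntitoneOn k (Ico t₁ T)) :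
    ∀ t ∈ Ico t₁ T, ∫ τ in t₁..t, k τ ^ 2 / (T - τ) ≤ k t₁ ^ 2 * Real.log ((T - t₁) / (T - t)) := by
  intro t ht
  have h1 : t₁ ≤ t := ht.1
  have hTt : 0 < T - t := sub_pos.2 ht.2
  have hmono : ∫ τ in t₁..t, k τ ^ 2 / (T - τ) ≤ ∫ τ in t₁..t, k t₁ ^ 2 / (T - τ) := by
    refine intervalIntegral.integral_mono_on h1
      (DepletionLadder.intervalIntegrable_coeff_sq_div hkm hk01 h1 ht.2)
      (DepletionLadder.intervalIntegrable_coeff_sq_div (k := fun _ => k t₁) measurable_const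
        (fun _ => hk01 t₁) h1 ht.2) ?_
    intro τ hτ
    have hTτ : 0 < T - τ := by linarith [hτ.2, ht.2]
    have hkτ : k τ ≤ k t₁ := hanti ⟨le_rfl, ht₁⟩ ⟨hτ.1, lt_of_le_of_lt hτ.2 ht.2⟩ hτ.1
    have hsq : k τ ^ 2 ≤ k t₁ ^ 2 := pow_le_pow_left₀ (hk01 τ).1 hkτ 2
    exact div_le_div_of_nonneg_right hsq hTτ.le
  have hsub : ∫ τ in t₁..t, (1 : ℝ) / (T - τ) = Real.log ((T - t₁) / (T - t)) := by
    have h := intervalIntegral.integral_comp_sub_left (fun x : ℝ => (1 : ℝ) / x) T (a := t₁) (b := t)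
    rw [h, integral_one_div_of_pos hTt (sub_pos.2 ht₁)]
  have hconst : ∫ τ in t₁..t, k t₁ ^ 2 / (T - τ) = k t₁ ^ 2 * Real.log ((T - t₁) / (T - t)) := by
    have hfun : (fun τ => k t₁ ^ 2 / (T - τ)) = fun τ => k t₁ ^ 2 * ((1 : ℝ) / (T - τ)) := by
      funext τ; ring
    rw [hfun, intervalIntegral.integral_const_mul, hsub]
  exact hmono.trans_eq hconst

/-- **Monotone-stratum rung for `NearExtremalTransiencePerFlow`.** The hypothesis is the crux's
flow-wise clause for ONE flow `u` with an antitone coefficient strictly below `κ⋆` at onset; the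
conclusion is LITERALLY the per-flow conclusion of the crux (`∃ θ < 1, ∀ κ universal, …`). -/
theorem netpf_rung_monotoneStratum {T : ℝ}
    (u : ℝ → EuclideanSpace ℝ (Fin 3) → EuclideanSpace ℝ (Fin 3))
    (hmono : ∃ t₁ ∈ Set.Ico 0 T, ∃ k : ℝ → ℝ, Measurable k ∧ (∀ τ, 0 ≤ k τ ∧ k τ ≤ 1) ∧
      (∀ t ∈ Set.Ico t₁ T, ∀ M : ℝ, (∀ x, ‖u t x‖ ≤ M) → |∫ x, ⟪Literature.Analysis.FluidPDE.curl (u t) x, fderiv ℝ (u t) x (Literature.Analysis.FluidPDE.curl (u t) x)⟫_ℝ| ≤ k t * M * Real.sqrt (∫ x, ‖Literature.Analysis.FluidPDE.curl (u t) x‖ ^ 2) * Real.sqrt (∫ x, Literature.Analysis.FluidPDE.frobeniusNormSq (fderiv ℝ (Literature.Analysis.FluidPDE.curl (u t)) x))) ∧ AntitoneOn k (Set.Ico t₁ T) ∧ k t₁ < sInf {κ : ℝ | (∀ (v : EuclideanSpace ℝ (Fin 3) → EuclideanSpace ℝ (Fin 3)) (M B : ℝ), ContDiff ℝ (⊤ :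 ℕ∞) v → Literature.Analysis.FluidPDE.VectorCalculus.IsDivFree v → (∀ x, ‖v x‖ ≤ M) → (∀ x, ‖fderiv ℝ v x‖ ≤ B) → (∫⁻ x, ‖iteratedFDeriv ℝ 0 v x‖ₑ ^ 2 < ⊤) → (∫⁻ x, ‖iteratedFDeriv ℝ 1 v x‖ₑ ^ 2 < ⊤) → (∫⁻ x, ‖iteratedFDeriv ℝ 2 v x‖ₑ ^ 2 < ⊤) → |∫ x, ⟪Literature.Analysis.FluidPDE.curl v x, fderiv ℝ v x (Literature.Analysis.FluidPDE.curl v x)⟫_ℝ| ≤ κ * M * Real.sqrt (∫ x, ‖Literature.Analysis.FluidPDE.curl v x‖ ^ 2) * Real.sqrt (∫ x, Literature.Analysis.FluidPDE.frobeniusNormSq (fderiv ℝ (Literature.Analysis.FluidPDE.curl v) x)))}) :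
    ∃ θ : ℝ, 0 ≤ θ ∧ θ < 1 ∧ ∀ κ : ℝ, (∀ (v : EuclideanSpace ℝ (Fin 3) → EuclideanSpace ℝ (Fin 3)) (M B : ℝ), ContDiff ℝ (⊤ : ℕ∞) v → Literature.Analysis.FluidPDE.VectorCalculus.IsDivFree v → (∀ x, ‖v x‖ ≤ M) → (∀ x, ‖fderiv ℝ v x‖ ≤ B) → (∫⁻ x, ‖iteratedFDeriv ℝ 0 v x‖ₑ ^ 2 < ⊤) → (∫⁻ x, ‖iteratedFDeriv ℝ 1 v x‖ₑ ^ 2 < ⊤) → (∫⁻ x, ‖iteratedFDeriv ℝ 2 v x‖ₑ ^ 2 < ⊤) → |∫ x, ⟪Literature.Analysis.FluidPDE.curl v x, fderiv ℝ v x (Literature.Analysis.FluidPDE.curl v x)⟫_ℝ| ≤ κ * M * Real.sqrt (∫ x, ‖Literature.Analysis.FluidPDE.curl v x‖ ^ 2) * Real.sqrt (∫ x, Literature.Analysis.FluidPDE.frobeniusNormSq (fderiv ℝ (Literature.Analysis.FluidPDE.curl v) x))) → ∃ t₁ ∈ Set.Ico 0 T, ∃ (k : ℝ → ℝ) (B :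 ℝ), Measurable k ∧ (∀ τ, 0 ≤ k τ ∧ k τ ≤ 1) ∧ (∀ t ∈ Set.Ico t₁ T, ∀ M : ℝ, (∀ x, ‖u t x‖ ≤ M) → |∫ x, ⟪Literature.Analysis.FluidPDE.curl (u t) x, fderiv ℝ (u t) x (Literature.Analysis.FluidPDE.curl (u t) x)⟫_ℝ| ≤ k t * M * Real.sqrt (∫ x, ‖Literature.Analysis.FluidPDE.curl (u t) x‖ ^ 2) * Real.sqrt (∫ x, Literature.Analysis.FluidPDE.frobeniusNormSq (fderiv ℝ (Literature.Analysis.FluidPDE.curl (u t)) x))) ∧ (∀ t ∈ Set.Ico t₁ T, ∫ τ in t₁..t, k τ ^ 2 / (T - τ) ≤ (θ * κ) ^ 2 * Real.log ((T - t₁) / (T - t)) + B) := by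
  obtain ⟨t₁, ht₁, k, hkm, hk01, hFW, hanti, hlt⟩ := hmono
  have hstar_pos : 0 < sInf {κ : ℝ | (∀ (v : EuclideanSpace ℝ (Fin 3) → EuclideanSpace ℝ (Fin 3)) (M B : ℝ), ContDiff ℝ (⊤ : ℕ∞) v → Literature.Analysis.FluidPDE.VectorCalculus.IsDivFree v → (∀ x, ‖v x‖ ≤ M) → (∀ x, ‖fderiv ℝ v x‖ ≤ B) → (∫⁻ x, ‖iteratedFDeriv ℝ 0 v x‖ₑ ^ 2 < ⊤) → (∫⁻ x, ‖iteratedFDeriv ℝ 1 v x‖ₑ ^ 2 < ⊤) → (∫⁻ x, ‖iteratedFDeriv ℝ 2 v x‖ₑ ^ 2 < ⊤) → |∫ x, ⟪Literature.Analysis.FluidPDE.curl v x, fderiv ℝ v x (Literature.Analysis.FluidPDE.curl v x)⟫_ℝ| ≤ κ * M * Real.sqrt (∫ x, ‖Literature.Analysis.FluidPDE.curl v x‖ ^ 2) * Real.sqrt (∫ x, Literature.Analysis.FluidPDE.frobeniusNormSq (fderiv ℝ (Literature.Analysis.FluidPDE.curl v) x)))} :=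
    lt_trans (by norm_num) DepletionLadder.sharpDepletion_gt
  refine ⟨k t₁ / sInf {κ : ℝ | (∀ (v : EuclideanSpace ℝ (Fin 3) → EuclideanSpace ℝ (Fin 3)) (M B : ℝ), ContDiff ℝ (⊤ : ℕ∞) v → Literature.Analysis.FluidPDE.VectorCalculus.IsDivFree v → (∀ x, ‖v x‖ ≤ M) → (∀ x, ‖fderiv ℝ v x‖ ≤ B) → (∫⁻ x, ‖iteratedFDeriv ℝ 0 v x‖ₑ ^ 2 < ⊤) → (∫⁻ x, ‖iteratedFDeriv ℝ 1 v x‖ₑ ^ 2 < ⊤) → (∫⁻ x, ‖iteratedFDeriv ℝ 2 v x‖ₑ ^ 2 < ⊤) → |∫ x, ⟪Literature.Analysis.FluidPDE.curl v x, fderiv ℝ v x (Literature.Analysis.FluidPDE.curl v x)⟫_ℝ| ≤ κ * M * Real.sqrt (∫ x, ‖Literature.Analysis.FluidPDE.curl v x‖ ^ 2) * Real.sqrt (∫ x, Literature.Analysis.FluidPDE.frobeniusNormSq (fderiv ℝ (Literature.Analysis.FluidPDE.curl v) x)))}, div_nonneg (hk01 t₁).1 hstar_pos.le, (div_lt_one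 hstar_pos).2 hlt, ?_⟩
  intro κ hκ
  have hle : sInf {κ : ℝ | (∀ (v : EuclideanSpace ℝ (Fin 3) → EuclideanSpace ℝ (Fin 3)) (M B : ℝ), ContDiff ℝ (⊤ : ℕ∞) v → Literature.Analysis.FluidPDE.VectorCalculus.IsDivFree v → (∀ x, ‖v x‖ ≤ M) → (∀ x, ‖fderiv ℝ v x‖ ≤ B) → (∫⁻ x, ‖iteratedFDeriv ℝ 0 v x‖ₑ ^ 2 < ⊤) → (∫⁻ x, ‖iteratedFDeriv ℝ 1 v x‖ₑ ^ 2 < ⊤) → (∫⁻ x, ‖iteratedFDeriv ℝ 2 v x‖ₑ ^ 2 < ⊤) → |∫ x, ⟪Literature.Analysis.FluidPDE.curl v x, fderiv ℝ v x (Literature.Analysis.FluidPDE.curl v x)⟫_ℝ| ≤ κ * M * Real.sqrt (∫ x, ‖Literature.Analysis.FluidPDE.curl v x‖ ^ 2) * Real.sqrt (∫ x, Literature.Analysis.FluidPDE.frobeniusNormSq (fderiv ℝ (Literature.Analysis.FluidPDE.curl v) x)))} ≤ κ := DepletionLadder.sharpDepletion_le hκ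
  refine ⟨t₁, ht₁, k, 0, hkm, hk01, hFW, ?_⟩
  intro t ht
  have hlm := logMean_of_antitone hkm hk01 ht₁.2 hanti t ht
  have hlog0 : 0 ≤ Real.log ((T - t₁) / (T - t)) :=
    Real.log_nonneg ((one_le_div (sub_pos.2 ht.2)).2 (by linarith [ht.1]))
  have hk0 : 0 ≤ k t₁ := (hk01 t₁).1
  have h1 : k t₁ ≤ k t₁ / sInf {κ : ℝ | (∀ (v : EuclideanSpace ℝ (Fin 3) → EuclideanSpace ℝ (Fin 3)) (M B : ℝ), ContDiff ℝ (⊤ : ℕ∞) v → Literature.Analysis.FluidPDE.VectorCalculus.IsDivFree v → (∀ x, ‖v x‖ ≤ M) → (∀ x, ‖fderiv ℝ v x‖ ≤ B) → (∫⁻ x, ‖iteratedFDeriv ℝ 0 v x‖ₑ ^ 2 < ⊤) → (∫⁻ x, ‖iteratedFDeriv ℝ 1 v x‖ₑ ^ 2 < ⊤) → (∫⁻ x, ‖iteratedFDeriv ℝ 2 v x‖ₑ ^ 2 < ⊤) → |∫ x, ⟪Literature.Analysis.FluidPDE.curl v x, fderiv ℝ v x (Literature.Analysis.FluidPDE.curl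 v x)⟫_ℝ| ≤ κ * M * Real.sqrt (∫ x, ‖Literature.Analysis.FluidPDE.curl v x‖ ^ 2) * Real.sqrt (∫ x, Literature.Analysis.FluidPDE.frobeniusNormSq (fderiv ℝ (Literature.Analysis.FluidPDE.curl v) x)))} * κ := by
    rw [div_mul_eq_mul_div, le_div_iff₀ hstar_pos]
    exact mul_le_mul_of_nonneg_left hle hk0
  have hcoef : k t₁ ^ 2 ≤ (k t₁ / sInf {κ : ℝ | (∀ (v : EuclideanSpace ℝ (Fin 3) → EuclideanSpace ℝ (Fin 3)) (M B : ℝ), ContDiff ℝ (⊤ : ℕ∞) v → Literature.Analysis.FluidPDE.VectorCalculus.IsDivFree v → (∀ x, ‖v x‖ ≤ M) → (∀ x, ‖fderiv ℝ v x‖ ≤ B) → (∫⁻ x, ‖iteratedFDeriv ℝ 0 v x‖ₑ ^ 2 < ⊤) → (∫⁻ x, ‖iteratedFDeriv ℝ 1 v x‖ₑ ^ 2 < ⊤) → (∫⁻ x, ‖iteratedFDeriv ℝ 2 v x‖ₑ ^ 2 < ⊤) → |∫ x, ⟪Literature.Analysis.FluidPDE.curl v x, fderiv ℝ v x (Literature.Analysis.FluidPDE.curl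 v x)⟫_ℝ| ≤ κ * M * Real.sqrt (∫ x, ‖Literature.Analysis.FluidPDE.curl v x‖ ^ 2) * Real.sqrt (∫ x, Literature.Analysis.FluidPDE.frobeniusNormSq (fderiv ℝ (Literature.Analysis.FluidPDE.curl v) x)))} * κ) ^ 2 := pow_le_pow_left₀ hk0 h1 2
  calc ∫ τ in t₁..t, k τ ^ 2 / (T - τ) ≤ k t₁ ^ 2 * Real.log ((T - t₁) / (T - t)) := hlm
    _ ≤ (k t₁ / sInf {κ : ℝ | (∀ (v : EuclideanSpace ℝ (Fin 3) → EuclideanSpace ℝ (Fin 3)) (M B : ℝ), ContDiff ℝ (⊤ : ℕ∞) v → Literature.Analysis.FluidPDE.VectorCalculus.IsDivFree v → (∀ x, ‖v x‖ ≤ M) → (∀ x, ‖fderiv ℝ v x‖ ≤ B) → (∫⁻ x, ‖iteratedFDeriv ℝ 0 v x‖ₑ ^ 2 < ⊤) → (∫⁻ x, ‖iteratedFDeriv ℝ 1 v x‖ₑ ^ 2 < ⊤) → (∫⁻ x, ‖iteratedFDeriv ℝ 2 v x‖ₑ ^ 2 < ⊤) → |∫ x, ⟪Literature.Analysis.FluidPDE.curl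 v x, fderiv ℝ v x (Literature.Analysis.FluidPDE.curl v x)⟫_ℝ| ≤ κ * M * Real.sqrt (∫ x, ‖Literature.Analysis.FluidPDE.curl v x‖ ^ 2) * Real.sqrt (∫ x, Literature.Analysis.FluidPDE.frobeniusNormSq (fderiv ℝ (Literature.Analysis.FluidPDE.curl v) x)))} * κ) ^ 2 * Real.log ((T - t₁) / (T - t)) + 0 := by
        rw [add_zero]; exact mul_le_mul_of_nonneg_right hcoef hlog0

end Summit.NavierStokesRegularity.NavierStokesRegularity.Theorems.DepletionLadder.PerFlow

end
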